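import Summits.FinalStateConjecture.FinalStateConjecture.Theorems.EIHFluxBalanceInertialRecessionRechartWhiteHoleAlgebra

/-!
# Route EIHFluxBalance — `InertialRecession`, re-charting: escape along the painted spin axis
# (white-hole exclusion for ROTATING holes, algebra)

Helper file for the crux `stmt-FinalStateConjecture-10166`
(`Summit.FinalStateConjecture.FinalStateConjecture.Theses.EIHFluxBalance.InertialRecession`),
stub `stub_rechart` of line `sublinear-is-free-clean-window-charges`.

Exact Kerr–Schild algebra on the spin axis `{x¹ = x² = 0, x³ > 0}` of `g_{M,a} = η + 2H ℓ ⊗ ℓ`: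
there `r = x³` (`radius_of_axis`), `H = M x³/((x³)² + a²)` (`scalarH_of_axis`),
`ℓ(w) = w⁰ + w³` (`nullCovector_of_axis`). Hence for the REST ESCAPE DIRECTION
`w₀ = −e₀ + ½e₃` (rest-PAST pointing, outgoing along the axis at half light speed) and the rest
escape configuration `ζ(s, τ) = (−s − τ)e₀ + (ρ + s/2)e₃`:
painted radius `ρ + s/2` EXACTLY and model value `g(w₀, w₀) = −3/4 + M r/(2(r² + a²)) ≤ −3/4 + M/(2r)`
(`kerr_bilin_escapeConfig`, `axis_value_le`) — negative inside and across the horizon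
`r₊ ≥ M`. Also: a Lorentz map with PAST-pointing `Λe₀` sends rest-past-pointing timelike
vectors to LAB-FUTURE-pointing ones (`lorentz_apply_zero_pos_of_neg`), so the lab escape
direction `Λw₀` has positive lab-time component; and the pull-back identities for chart points
`x = c + Λζ`.

[Kerr–Schild 1965, §2; Visser arXiv:0706.0622, (33)–(35); O'Neill 1983, Ch. 9, pp. 233–236;
folklore]
-/

noncomputable section

set_option linter.dupNamespace false

open scoped InnerProductSpace
open Set Function Literature.Geometry.Lorentzian

namespace Summit.FinalStateConjecture.FinalStateConjecture.Theorems

/-! ### Kerr–Schild data on the spin axis -/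

/-- On the positive spin axis the spatial radius is `x³`. [folklore] -/
theorem spatialNorm_of_axis {x : E4} (h1 : x 1 = 0) (h2 : x 2 = 0) (h3 : 0 ≤ x 3) :
    E4.spatialNorm x = x 3 := by
  have hsq : E4.spatialNorm x ^ 2 = x 3 ^ 2 := by rw [E4.spatialNorm_sq, h1, h2]; ring
  exact (pow_left_inj₀ (E4.spatialNorm_nonneg x) h3 two_ne_zero).1 hsq

/-- **On the positive spin axis the Kerr–Schild radius is `x³`** (the discriminant of the defining
quartic is `((x³)² + a²)²`). Visser arXiv:0706.0622, (35). [folklore] -/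
theorem radius_of_axis (a : ℝ) {x : E4} (h1 : x 1 = 0) (h2 : x 2 = 0) (h3 : 0 ≤ x 3) :
    Kerr.radius a x = x 3 := by
  have hρ : E4.spatialNorm x ^ 2 = x 3 ^ 2 := by rw [spatialNorm_of_axis h1 h2 h3]
  have hsq : Kerr.radius a x ^ 2 = x 3 ^ 2 := by
    rw [Kerr.radius_sq, hρ,
      show (x 3 ^ 2 - a ^ 2) ^ 2 + 4 * a ^ 2 * x 3 ^ 2 = (x 3 ^ 2 + a ^ 2) ^ 2 by ring,
      Real.sqrt_sq (by positivity)]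
    ring
  exact (pow_left_inj₀ (Kerr.radius_nonneg a x) h3 two_ne_zero).1 hsq

/-- On the positive spin axis `H = M x³/((x³)² + a²)`. Visser arXiv:0706.0622, (33). [folklore] -/
theorem scalarH_of_axis (M a : ℝ) {x : E4} (h1 : x 1 = 0) (h2 : x 2 = 0) (h3 : 0 < x 3) :
    Kerr.scalarH M a x = M * x 3 / (x 3 ^ 2 + a ^ 2) := by
  unfold Kerr.scalarH
  rw [radius_of_axis a h1 h2 h3.le]
  have h3' : x 3 ≠ 0 := h3.ne'
  have hden : x 3 ^ 2 + a ^ 2 ≠ 0 := by positivity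
  field_simp

/-- On the positive spin axis `ℓ(w) = w⁰ + w³`. Visser arXiv:0706.0622, (34). [folklore] -/
theorem nullCovector_of_axis (a : ℝ) {x : E4} (h1 : x 1 = 0) (h2 : x 2 = 0) (h3 : 0 < x 3)
    (w : E4) : Kerr.nullCovector a x w = w 0 + w 3 := by
  have hr := radius_of_axis a h1 h2 h3.le
  have h3' : x 3 ≠ 0 := h3.ne'
  simp only [Kerr.nullCovector, Kerr.nullCovectorFun, E4.covector_apply, Fin.sum_univ_four,
    Fin.isValue, Matrix.cons_val_zero, Matrix.cons_val_one, Matrix.cons_val, hr, h1, h2,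
    mul_zero, add_zero, sub_zero, zero_div, zero_mul, div_self h3', one_mul]

/-- **The Kerr–Schild form on the positive spin axis**:
`g(v, w) = η(v, w) + 2 (M x³/((x³)² + a²)) (v⁰ + v³)(w⁰ + w³)`. [folklore] -/
theorem kerr_bilin_of_axis (M a : ℝ) {x : E4} (h1 : x 1 = 0) (h2 : x 2 = 0) (h3 : 0 < x 3)
    (v w : E4) : Kerr.bilin M a x v w =
      Minkowski.bilin v w + 2 * (M * x 3 / (x 3 ^ 2 + a ^ 2)) * ((v 0 + v 3) * (w 0 + w 3)) := by
  rw [Kerr.bilin_apply, scalarH_of_axis M a h1 h2 h3, nullCovector_of_axis a h1 h2 h3,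
    nullCovector_of_axis a h1 h2 h3]

/-! ### The rest escape direction and configuration -/

/-- Components of the rest escape direction `w₀ = −e₀ + ½e₃`. [folklore] -/
theorem escapeDir_apply :
    (-E4.basisVector 0 + (1 / 2 : ℝ) • E4.basisVector 3 : E4) 0 = -1 ∧
      (-E4.basisVector 0 + (1 / 2 : ℝ) • E4.basisVector 3 : E4) 1 = 0 ∧
      (-E4.basisVector 0 + (1 / 2 : ℝ) • E4.basisVector 3 : E4) 2 = 0 ∧
      (-E4.basisVector 0 + (1 / 2 : ℝ) • E4.basisVector 3 : E4) 3 = 1 / 2 := by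
  refine ⟨?_, ?_, ?_, ?_⟩ <;> simp [Fin.ext_iff]

/-- `η(w₀, w₀) = −3/4`: the rest escape direction is timelike. [folklore] -/
theorem minkowski_escapeDir :
    Minkowski.bilin (-E4.basisVector 0 + (1 / 2 : ℝ) • E4.basisVector 3 : E4)
      (-E4.basisVector 0 + (1 / 2 : ℝ) • E4.basisVector 3) = -(3 / 4) := by
  obtain ⟨h0, h1, h2, h3⟩ := escapeDir_apply
  rw [Minkowski.bilin_apply, Fin.sum_univ_three]
  simp only [Fin.succ_zero_eq_one, Fin.succ_one_eq_two]
  rw [show (2 : Fin 3).succ = (3 : Fin 4) from rfl, h0, h1, h2, h3]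
  norm_num

/-- `‖w₀‖ ≤ 3/2`. [folklore] -/
theorem norm_escapeDir_le :
    ‖(-E4.basisVector 0 + (1 / 2 : ℝ) • E4.basisVector 3 : E4)‖ ≤ 3 / 2 := by
  calc ‖(-E4.basisVector 0 + (1 / 2 : ℝ) • E4.basisVector 3 : E4)‖
      ≤ ‖(-E4.basisVector 0 : E4)‖ + ‖((1 / 2 : ℝ) • E4.basisVector 3 : E4)‖ := norm_add_le _ _
    _ = 3 / 2 := by
        rw [norm_neg, norm_smul, PiLp.norm_single, PiLp.norm_single,
          norm_one, Real.norm_eq_abs]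
        norm_num

/-- Components of the rest escape configuration `ζ(s, τ) = (−s − τ)e₀ + (ρ + s/2)e₃`.
[folklore] -/
theorem escapeConfig_apply (ρ s τ : ℝ) :
    ((-s - τ) • E4.basisVector 0 + (ρ + s / 2) • E4.basisVector 3 : E4) 0 = -s - τ ∧
      ((-s - τ) • E4.basisVector 0 + (ρ + s / 2) • E4.basisVector 3 : E4) 1 = 0 ∧
      ((-s - τ) • E4.basisVector 0 + (ρ + s / 2) • E4.basisVector 3 : E4) 2 = 0 ∧
      ((-s - τ) • E4.basisVector 0 + (ρ + s / 2) • E4.basisVector 3 : E4) 3 = ρ + s / 2 := by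
  refine ⟨?_, ?_, ?_, ?_⟩ <;> simp [Fin.ext_iff]

/-- The rest escape configuration is the base point moved along `w₀` and back along `e₀`:
`ρ e₃ + s w₀ − τ e₀ = ζ(s, τ)`. [folklore] -/
theorem escapeConfig_eq (ρ s τ : ℝ) :
    (ρ • E4.basisVector 3 + s • (-E4.basisVector 0 + (1 / 2 : ℝ) • E4.basisVector 3) -
        τ • E4.basisVector 0 : E4) =
      (-s - τ) • E4.basisVector 0 + (ρ + s / 2) • E4.basisVector 3 := by
  rw [smul_add, smul_neg, smul_smul, sub_smul, add_smul, neg_smul,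
    show s * (1 / 2) = s / 2 by ring]
  abel

/-- `‖ζ(s, τ)‖ ≤ |s| + |τ| + |ρ + s/2|`. [folklore] -/
theorem norm_escapeConfig_le (ρ s τ : ℝ) :
    ‖((-s - τ) • E4.basisVector 0 + (ρ + s / 2) • E4.basisVector 3 : E4)‖ ≤
      |s| + |τ| + |ρ + s / 2| := by
  calc ‖((-s - τ) • E4.basisVector 0 + (ρ + s / 2) • E4.basisVector 3 : E4)‖
      ≤ ‖((-s - τ) • E4.basisVector 0 : E4)‖ + ‖((ρ + s / 2) • E4.basisVector 3 : E4)‖ :=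
        norm_add_le _ _
    _ = |-s - τ| + |ρ + s / 2| := by
        rw [norm_smul, norm_smul, PiLp.norm_single, PiLp.norm_single,
          norm_one, mul_one, mul_one, Real.norm_eq_abs, Real.norm_eq_abs]
    _ ≤ |s| + |τ| + |ρ + s / 2| := by
        have : |-s - τ| ≤ |s| + |τ| := by
          rw [show -s - τ = -(s + τ) by ring, abs_neg]; exact abs_add_le s τ
        linarith

/-- **Exact painted radius and model value of the rest escape configuration**: for `0 < ρ + s/2`,
`r(ζ(s,τ)) = ρ + s/2` and `g_{M,a}(ζ(s,τ))(w₀, w₀) = −3/4 + M(ρ + s/2)/(2((ρ + s/2)² + a²))`.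
[folklore] -/
theorem kerr_bilin_escapeConfig (M a ρ s τ : ℝ) (h : 0 < ρ + s / 2) :
    Kerr.radius a ((-s - τ) • E4.basisVector 0 + (ρ + s / 2) • E4.basisVector 3) = ρ + s / 2 ∧
      Kerr.bilin M a ((-s - τ) • E4.basisVector 0 + (ρ + s / 2) • E4.basisVector 3)
          (-E4.basisVector 0 + (1 / 2 : ℝ) • E4.basisVector 3)
          (-E4.basisVector 0 + (1 / 2 : ℝ) • E4.basisVector 3) =
        -(3 / 4) + M * (ρ + s / 2) / (2 * ((ρ + s / 2) ^ 2 + a ^ 2)) := by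
  obtain ⟨-, h1, h2, h3⟩ := escapeConfig_apply ρ s τ
  have h3' : 0 < ((-s - τ) • E4.basisVector 0 + (ρ + s / 2) • E4.basisVector 3 : E4) 3 := by
    rw [h3]; exact h
  obtain ⟨w0, -, -, w3⟩ := escapeDir_apply
  refine ⟨by rw [radius_of_axis a h1 h2 h3'.le, h3], ?_⟩
  rw [kerr_bilin_of_axis M a h1 h2 h3', minkowski_escapeDir, w0, w3, h3]
  have hden : (ρ + s / 2) ^ 2 + a ^ 2 ≠ 0 := by positivity
  field_simp
  ring

/-- The own model value across the horizon: `M r/(2(r² + a²)) ≤ M/(2r₀)` for `r ≥ r₀ > 0`,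
`M ≥ 0`. [folklore] -/
theorem axis_value_le {M r r₀ : ℝ} (hM : 0 ≤ M) (hr₀ : 0 < r₀) (hr : r₀ ≤ r) (a : ℝ) :
    M * r / (2 * (r ^ 2 + a ^ 2)) ≤ M / (2 * r₀) := by
  have hr0 : 0 < r := hr₀.trans_le hr
  rw [div_le_div_iff₀ (by positivity) (by positivity)]
  have h1 : M * r * (2 * r₀) ≤ M * r * (2 * r) := by
    apply mul_le_mul_of_nonneg_left _ (by positivity); linarith
  nlinarith [sq_nonneg a, mul_nonneg hM (sq_nonneg a)]

/-! ### Orientation: past-pointing frames flip the rest-past to the lab-future -/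

/-- A timelike vector has spatial part shorter than its time component: `‖w~‖ < |w⁰|`.
[folklore] -/
theorem norm_spatial_lt_abs_of_timelike {w : E4} (hw : Minkowski.bilin w w < 0) :
    ‖E4.spatial w‖ < |w 0| := by
  rw [Lorentz.minkowski_bilin_eq_inner, real_inner_self_eq_norm_sq] at hw
  have h : ‖E4.spatial w‖ ^ 2 < |w 0| ^ 2 := by rw [sq_abs]; nlinarith
  exact lt_of_pow_lt_pow_left₀ 2 (abs_nonneg _) h

/-- Two past-pointing timelike vectors have negative Minkowski product (they lie in the same
cone; reversed Cauchy–Schwarz). O'Neill 1983, Ch. 5, Lemma 5.26. [folklore] -/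
theorem minkowski_neg_of_pastPointing {w u : E4} (hw : Minkowski.bilin w w < 0) (hw0 : w 0 < 0)
    (hu : Minkowski.bilin u u < 0) (hu0 : u 0 < 0) : Minkowski.bilin w u < 0 := by
  have h1 := norm_spatial_lt_abs_of_timelike hw
  have h2 := norm_spatial_lt_abs_of_timelike hu
  rw [abs_of_neg hw0] at h1
  rw [abs_of_neg hu0] at h2
  rw [Lorentz.minkowski_bilin_eq_inner]
  have hcs : inner ℝ (E4.spatial w) (E4.spatial u) ≤ ‖E4.spatial w‖ * ‖E4.spatial u‖ :=
    real_inner_le_norm _ _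
  have hprod : ‖E4.spatial w‖ * ‖E4.spatial u‖ < (-w 0) * (-u 0) :=
    mul_lt_mul'' h1 h2 (norm_nonneg _) (norm_nonneg _)
  nlinarith

/-- `(Λ⁻¹e₀)⁰ = (Λe₀)⁰` and `η(Λ⁻¹e₀, Λ⁻¹e₀) = −1`. O'Neill 1983, Ch. 9, p. 233. [folklore] -/
theorem lorentz_symm_basisVector_zero (Λ : lorentzGroup) :
    ((Λ : E4 ≃L[ℝ] E4).symm (E4.basisVector 0)) 0 =
        ((Λ : E4 ≃L[ℝ] E4) (E4.basisVector 0)) 0 ∧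
      Minkowski.bilin ((Λ : E4 ≃L[ℝ] E4).symm (E4.basisVector 0))
        ((Λ : E4 ≃L[ℝ] E4).symm (E4.basisVector 0)) = -1 := by
  constructor
  · rw [lorentz_symm_apply_zero, minkowski_bilin_basisVector_zero_left, neg_neg]
  · rw [lorentzGroup.minkowski_symm_apply, Minkowski.bilin_basisVector_zero]

/-- **A frame with past-pointing `Λe₀` maps rest-past-pointing timelike vectors to
lab-future-pointing ones**: if `(Λe₀)⁰ < 0`, `η(w, w) < 0` and `w⁰ < 0`, then `0 < (Λw)⁰`
(`(Λw)⁰ = −η(w, Λ⁻¹e₀)` and `Λ⁻¹e₀` is past-pointing timelike). O'Neill 1983, Ch. 5,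
Lemma 5.26; Ch. 9, p. 233. [folklore] -/
theorem lorentz_apply_zero_pos_of_neg (Λ : lorentzGroup)
    (hΛ : ((Λ : E4 ≃L[ℝ] E4) (E4.basisVector 0)) 0 < 0) {w : E4}
    (hw : Minkowski.bilin w w < 0) (hw0 : w 0 < 0) : 0 < ((Λ : E4 ≃L[ℝ] E4) w) 0 := by
  obtain ⟨hu0, huu⟩ := lorentz_symm_basisVector_zero Λ
  have h1 : ((Λ : E4 ≃L[ℝ] E4) w) 0 =
      -Minkowski.bilin w ((Λ : E4 ≃L[ℝ] E4).symm (E4.basisVector 0)) := by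
    have h := minkowski_bilin_basisVector_zero_left ((Λ : E4 ≃L[ℝ] E4) w)
    have h' := Λ.2 w ((Λ : E4 ≃L[ℝ] E4).symm (E4.basisVector 0))
    rw [ContinuousLinearEquiv.apply_symm_apply, Minkowski.bilin_symm] at h'
    linarith
  rw [h1]
  have := minkowski_neg_of_pastPointing hw hw0 (by rw [huu]; norm_num) (by rw [hu0]; exact hΛ)
  linarith

/-- The lab escape direction `W₀ = Λw₀` of an anti-orthochronous frame has `0 < W₀⁰`.
[folklore] -/
theorem lorentz_escapeDir_apply_zero_pos (Λ : lorentzGroup)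
    (hΛ : ((Λ : E4 ≃L[ℝ] E4) (E4.basisVector 0)) 0 < 0) :
    0 < ((Λ : E4 ≃L[ℝ] E4) (-E4.basisVector 0 + (1 / 2 : ℝ) • E4.basisVector 3)) 0 :=
  lorentz_apply_zero_pos_of_neg Λ hΛ (by rw [minkowski_escapeDir]; norm_num)
    (by rw [escapeDir_apply.1]; norm_num)

/-! ### Pull-back identities for chart points `x = c + Λζ` -/

/-- `Λ⁻¹((c + Λζ) − c) = ζ`. [folklore] -/
theorem poincareInv_centre_add (Λ : lorentzGroup) (c ζ : E4) :
    poincareInv Λ c (c + (Λ : E4 ≃L[ℝ] E4) ζ) = ζ := by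
  rw [poincareInv, add_sub_cancel_left, ContinuousLinearEquiv.symm_apply_apply]

/-- **The painted form at a chart point, evaluated on frame vectors, is the rest form**:
`boostedKerrBilin Λ c M a (c + Λζ) (Λv) (Λw) = g_{M,a}(ζ)(v, w)`. Kerr–Schild 1965, §2.
[folklore] -/
theorem boostedKerrBilin_centre_add (Λ : lorentzGroup) (c ζ : E4) (M a : ℝ) (v w : E4) :
    boostedKerrBilin Λ c M a (c + (Λ : E4 ≃L[ℝ] E4) ζ) ((Λ : E4 ≃L[ℝ] E4) v)
        ((Λ : E4 ≃L[ℝ] E4) w) = Kerr.bilin M a ζ v w := by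
  rw [boostedKerrBilin_apply, poincareInv_centre_add, ContinuousLinearEquiv.symm_apply_apply,
    ContinuousLinearEquiv.symm_apply_apply]

/-- **The painted form through the inverse frame as an operator**: with `P = Λ⁻¹`,
`boostedKerrBilin Λ c M a x v w = g_{M,a}(P(x − c))(Pv, Pw)`. [folklore] -/
theorem boostedKerrBilin_eq_symm_clm (Λ : lorentzGroup) (c : E4) (M a : ℝ) (x v w : E4) :
    boostedKerrBilin Λ c M a x v w =
      Kerr.bilin M a ((((Λ : E4 ≃L[ℝ] E4).symm : E4 ≃L[ℝ] E4) : E4 →L[ℝ] E4) (x - c))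
        ((((Λ : E4 ≃L[ℝ] E4).symm : E4 ≃L[ℝ] E4) : E4 →L[ℝ] E4) v)
        ((((Λ : E4 ≃L[ℝ] E4).symm : E4 ≃L[ℝ] E4) : E4 →L[ℝ] E4) w) := by
  rw [boostedKerrBilin_apply]; rfl

/-- The painted radius through the inverse frame as an operator. [folklore] -/
theorem radius_poincareInv_eq_symm_clm (Λ : lorentzGroup) (c : E4) (a : ℝ) (x : E4) :
    Kerr.radius a (poincareInv Λ c x) =
      Kerr.radius a ((((Λ : E4 ≃L[ℝ] E4).symm : E4 ≃L[ℝ] E4) : E4 →L[ℝ] E4) (x - c)) := rfl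

/-- Registered one-line form (stub `radius_of_axis_rechart` of the crux item) of
`radius_of_axis`. [folklore] -/
theorem radius_of_axis_rechart : open Literature.Geometry.Lorentzian in ∀ (a : ℝ) {x : E4}, x 1 = 0 → x 2 = 0 → 0 ≤ x 3 → Kerr.radius a x = x 3 :=
  fun a _ h1 h2 h3 ↦ radius_of_axis a h1 h2 h3

end Summit.FinalStateConjecture.FinalStateConjecture.Theorems
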